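import Summits.QuantumFields.BalabanUV.T4Continuum.Support.NE7SliceIterationStateFactsNL0
import Summits.QuantumFields.BalabanUV.T4Continuum.Support.NE7SliceStepOneStep
import HarnessLib

/-!
# NE7SliceStepOneStepNL0 — ONE STEP OF THE (S1) ITERATION WITH THE FRAME-FREE RIGHT INVERSE: the error field `E′ := J + (R₀φ⁰ − R₀φ¹)` is skew, periodic, exact over the corner junk
# (`dirIter E′ = gaugeDir_V j_c`), sized by `supC0`, `supCurlC0`, and the next tangent part `T¹ = Ỹ⁰ + E′` splits with the displayed sizes (memo ROAD-G103 §6, repair (R1″), file (C1)-3):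
# VERBATIM `NE7SliceStepErrorField` §ErrorField + `NE7SliceStepOneStep` with `rightInvW ↦ NE7FrameFreeRightInverse.rightInvW0`

Cell `pub-balaban`, rung (B)+1 sub-cell t4, lineage `b2b-balaban-t4-ne7-p1`, generation 103 (CRUX PROVER NE7 #1 = OWNER of BINDER row NE7).  Memo `t4/b2b-balaban-t4-ne7-p1-g103/ROAD-G103.md` §6.
The kinematic step identities (`NE7SliceStepIdentities`), the datum-difference letter `NE7SliceStepErrorSizes.sup_dphi_le` and the sized split of an exact error field
`NE7SliceStepContraction.split_error_sized` do not see the right inverse and are used BY NAME; only the five error-field facts and the one-step split are re-issued for `R₀`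
(sup constant `supC0 = supC(1+4d·64^d·frameC)`, curl constant `supCurlC0 = supCurlC + 4·64^d·frameC·supC`, one extra def-parameter `hE`).
WHAT ([folklore]; 0 def, 0 sorry).  §1 `errorField_skew0`, `errorField_periodic0`, `norm_errorField_le0`, `norm_curlAt_errorField_le0`.  §2 `dirIter_errorField0`, **`one_step_split_sized0`**.
HONEST FRAMING (page 1): linear bookkeeping over landed letters at ONE background, (L) displayed as a hypothesis; nothing of Bałaban's asserted; NOT (S1), NOT NE7; spine 0∕9; finite T⁴ rung (B)+1 —
NOT infinite volume, NOT mass gap, NOT BetaPertH, NOT Clay.  Continuum YM on T⁴ ⇐ BetaPertH ∧ nine spine estimates (0/9 proved); BetaPertH ⇐ (D1) ∧ (D4) ∧ CAP+tail; G-an2-4 gates asym, D1 and NE2/3/4.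
-/

set_option autoImplicit false

open scoped BigOperators Matrix.Norms.L2Operator
open Finset

namespace Summit.QuantumFields.BalabanUV.T4Continuum.NE7SliceStepOneStepNL0

open Literature.MathematicalPhysics.QuantumFieldTheory.Balaban1983to89
open B7Prop1Explicit B7Prop2Explicit
open T4AveragingDeficitWall (IsUnitaryCfg IsSkewDir SmallField Ad curlAt curl)
open T4AveragingDeficitWallBoundary (IsPeriodicCfg)
open AveragingDeficitPeriodicCounting (IsPeriodicDir)
open AveragingDeficitTwoLevelPrep (prop1Radius)
open AveragingDeficitMultiLevelPrep (cavgIter LevelSmall tower)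
open BlockAveragePushDirGauge (gaugeDir)
open NE3TangentCovariantTower (dirIter framePotW dirIter_add)
open NE3ResidualSliceRep (dirIter_sub)
open NE3CurvedFrameKill (framePotW_add)
open NE3CovariantBlockMean (bmeanIterW)
open NE3RightInverseSupLetters (frameC supC)
open NE3HatInvCurlLetters (supCurlC)
open NE3QbarIterCovLiftPrep (cruxC)
open NE7FrameFreeRightInverse (rightInvW0 dirIter_rightInvW0 isSkewDir_rightInvW0 isPeriodicDir_rightInvW0 norm_rightInvW0_le norm_curlAt_rightInvW0_le rightInvW0_sub supC0 supCurlC0)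
open NE3LinearisedAverageSup (curvSum)
open NE3EnergyHessBilin (curlAt_add)
open NE7MeanZeroGaugeSliceW (energyBlockLandauW)
open NE7SliceSplitUnique (mem_energyBlockLandauW_add)
open SpreadLift (loopRad)
open NE7SliceStepContraction (split_error_sized)
open NE7SliceStepErrorSizes (sup_dphi_le)
open NE7SliceStepErrorField (isSkewDir_sub)

noncomputable section

variable {d : ℕ} {n : Type*} [Fintype n] [DecidableEq n]

section OneStep

variable [Nonempty n] {L : ℕ} (hL : 2 ≤ L) (k : ℕ) {N : ℕ} [NeZero N] {W : Site d → Fin d → (Matrix n n ℂ)ˣ} {x : ℝ}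
  (hWu : IsUnitaryCfg W) (hWP : IsPeriodicCfg W ((tower L N (k + 1) : ℕ) : ℤ)) (hx : 0 ≤ x) (hs : LevelSmall d L k x) (hWx : SmallField W x)
  (hθ : cruxC d L * (((L : ℝ) ^ (k + 1)) ^ 2 * x) < 1)
  (hE : 4 * (d : ℝ) ^ 2 * ((L : ℝ) ^ (k + 1) - 1) ^ 2 * x + 16 * d * loopRad d L ((prop1Radius d L)^[k] x) ≤ 1 / 2)
  (hε : ((L : ℝ) ^ (k + 1)) ^ 2 * x ≤ 1)
  {φ0 φ1 : Site d → Fin d → Matrix n n ℂ} (hφ0 : IsSkewDir φ0) (hφ1 : IsSkewDir φ1) (hφ0P : IsPeriodicDir φ0 (N : ℤ)) (hφ1P : IsPeriodicDir φ1 (N : ℤ))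
  {J : Site d → Fin d → Matrix n n ℂ} {jc : Site d → Matrix n n ℂ}

/-! ## §1 The error field `E′ = J + (R₀φ⁰ − R₀φ¹)`: skew, periodic, sized -/

/-- **THE ERROR FIELD IS SKEW** (`J` skew). [folklore] -/
theorem errorField_skew0 (hJs : IsSkewDir J) :
    IsSkewDir (fun y κ => J y κ + (rightInvW0 hL k hWu hx hs hWx N hθ hE hφ0 y κ - rightInvW0 hL k hWu hx hs hWx N hθ hE hφ1 y κ)) := fun y κ =>
  (skewAdjoint _).add_mem (hJs y κ) ((skewAdjoint _).sub_mem (isSkewDir_rightInvW0 hL k hWu hx hs hWx N hθ hE hφ0 y κ) (isSkewDir_rightInvW0 hL k hWu hx hs hWx N hθ hE hφ1 y κ))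

include hWP in
/-- **THE ERROR FIELD IS `(tower L N (k+1))`-PERIODIC** (`J` periodic, `W` periodic). [folklore] -/
theorem errorField_periodic0 (hJP : IsPeriodicDir J ((tower L N (k + 1) : ℕ) : ℤ)) :
    IsPeriodicDir (fun y κ => J y κ + (rightInvW0 hL k hWu hx hs hWx N hθ hE hφ0 y κ - rightInvW0 hL k hWu hx hs hWx N hθ hE hφ1 y κ)) ((tower L N (k + 1) : ℕ) : ℤ) := by
  intro y i μ
  have h0 := isPeriodicDir_rightInvW0 hL k hWu hx hs hWx N hθ hE hφ0 hWP y i μ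
  have h1 := isPeriodicDir_rightInvW0 hL k hWu hx hs hWx N hθ hE hφ1 hWP y i μ
  simp only [hJP y i μ, h0, h1]

include hWP hε in
/-- **THE SUP SIZE OF THE ERROR FIELD**: with `φ⁰ − φ¹ = −dirIter J + gaugeDir_V j_c`, `‖J‖ ≤ e_J`, `‖j_c‖ ≤ e_c` (`J` skew periodic, `curvSum ≤ 2L∕3`, `M²x ≤ 1`),
`‖E′(b)‖ ≤ e_J + supC∕(M·(1 − cruxC·M²x))·((3+12d)·M·e_J + 2e_c)` (`M = L^{k+1}`). [folklore] -/
theorem norm_errorField_le0 (hA : curvSum d L (k + 1) x ≤ 2 / 3 * L) (hJs : IsSkewDir J) (hJP : IsPeriodicDir J ((tower L N (k + 1) : ℕ) : ℤ))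
    {jc : Site d → Matrix n n ℂ} (hdφ : ∀ z κ, φ0 z κ - φ1 z κ = -dirIter L (k + 1) W J z κ + gaugeDir (cavgIter L (k + 1) W) jc z κ)
    {eJ ec : ℝ} (heJ0 : 0 ≤ eJ) (hec0 : 0 ≤ ec) (hJ : ∀ y κ, ‖J y κ‖ ≤ eJ) (hjc : ∀ z, ‖jc z‖ ≤ ec) (y : Site d) (κ : Fin d) :
    ‖J y κ + (rightInvW0 hL k hWu hx hs hWx N hθ hE hφ0 y κ - rightInvW0 hL k hWu hx hs hWx N hθ hE hφ1 y κ)‖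
      ≤ eJ + supC0 d L / ((L : ℝ) ^ (k + 1) * (1 - cruxC d L * (((L : ℝ) ^ (k + 1)) ^ 2 * x))) * ((3 + 12 * (d : ℝ)) * (L : ℝ) ^ (k + 1) * eJ + 2 * ec) := by
  have hφψ : IsSkewDir (fun y μ => φ0 y μ - φ1 y μ) := isSkewDir_sub hφ0 hφ1
  have hsub := rightInvW0_sub hL k hWu hx hs hWx N hθ hE hφ0 hφ1 hφψ y κ
  rw [← hsub]
  have hφs : ∀ (z : Site d) (μ : Fin d), ‖(fun y μ => φ0 y μ - φ1 y μ) z μ‖ ≤ (3 + 12 * (d : ℝ)) * (L : ℝ) ^ (k + 1) * eJ + 2 * ec := fun z μ => by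
    simp only [hdφ z μ]
    exact sup_dphi_le hL k hWu hWP hx hs hWx hA hJs hJP heJ0 hJ hjc z μ
  have hs0 : 0 ≤ (3 + 12 * (d : ℝ)) * (L : ℝ) ^ (k + 1) * eJ + 2 * ec := by positivity
  exact (norm_add_le _ _).trans (add_le_add (hJ y κ) (norm_rightInvW0_le hL k hWu hx hs hWx N hθ hE hφψ hε hs0 hφs y κ))

include hWP hε in
/-- **THE CURL SIZE OF THE ERROR FIELD** (same data, `‖curlAt W J z μ ν‖ ≤ c_J` for `μ ≠ ν`): for `μ ≠ ν`,
`‖curlAt W E′ z μ ν‖ ≤ c_J + supCurlC∕(M²·(1 − cruxC·M²x))·((3+12d)·M·e_J + 2e_c)`. [folklore] -/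
theorem norm_curlAt_errorField_le0 (hA : curvSum d L (k + 1) x ≤ 2 / 3 * L) (hJs : IsSkewDir J) (hJP : IsPeriodicDir J ((tower L N (k + 1) : ℕ) : ℤ))
    {jc : Site d → Matrix n n ℂ} (hdφ : ∀ z κ, φ0 z κ - φ1 z κ = -dirIter L (k + 1) W J z κ + gaugeDir (cavgIter L (k + 1) W) jc z κ)
    {eJ cJ ec : ℝ} (heJ0 : 0 ≤ eJ) (hec0 : 0 ≤ ec) (hJ : ∀ y κ, ‖J y κ‖ ≤ eJ)
    (hcJ : ∀ (z : Site d) (μ ν : Fin d), μ ≠ ν → ‖curlAt W J z μ ν‖ ≤ cJ) (hjc : ∀ z, ‖jc z‖ ≤ ec) (z : Site d) {μ ν : Fin d} (hμν : μ ≠ ν) :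
    ‖curlAt W (fun y κ => J y κ + (rightInvW0 hL k hWu hx hs hWx N hθ hE hφ0 y κ - rightInvW0 hL k hWu hx hs hWx N hθ hE hφ1 y κ)) z μ ν‖
      ≤ cJ + supCurlC0 d L / (((L : ℝ) ^ (k + 1)) ^ 2 * (1 - cruxC d L * (((L : ℝ) ^ (k + 1)) ^ 2 * x))) * ((3 + 12 * (d : ℝ)) * (L : ℝ) ^ (k + 1) * eJ + 2 * ec) := by
  have hφψ : IsSkewDir (fun y μ => φ0 y μ - φ1 y μ) := isSkewDir_sub hφ0 hφ1
  have hfun : (fun y κ => J y κ + (rightInvW0 hL k hWu hx hs hWx N hθ hE hφ0 y κ - rightInvW0 hL k hWu hx hs hWx N hθ hE hφ1 y κ))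
      = J + rightInvW0 hL k hWu hx hs hWx N hθ hE hφψ := by
    funext y κ
    rw [Pi.add_apply, Pi.add_apply, rightInvW0_sub hL k hWu hx hs hWx N hθ hE hφ0 hφ1 hφψ y κ]
  rw [hfun, curlAt_add]
  have hφs : ∀ (z : Site d) (μ : Fin d), ‖(fun y μ => φ0 y μ - φ1 y μ) z μ‖ ≤ (3 + 12 * (d : ℝ)) * (L : ℝ) ^ (k + 1) * eJ + 2 * ec := fun z μ => by
    simp only [hdφ z μ]
    exact sup_dphi_le hL k hWu hWP hx hs hWx hA hJs hJP heJ0 hJ hjc z μ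
  have hs0 : 0 ≤ (3 + 12 * (d : ℝ)) * (L : ℝ) ^ (k + 1) * eJ + 2 * ec := by positivity
  have hR : ‖curlAt W (rightInvW0 hL k hWu hx hs hWx N hθ hE hφψ) z μ ν‖
      ≤ supCurlC0 d L / (((L : ℝ) ^ (k + 1)) ^ 2 * (1 - cruxC d L * (((L : ℝ) ^ (k + 1)) ^ 2 * x))) * ((3 + 12 * (d : ℝ)) * (L : ℝ) ^ (k + 1) * eJ + 2 * ec) :=
    norm_curlAt_rightInvW0_le hL k hWu hx hs hWx N hθ hE hφψ hε hs0 hφs z hμν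
  exact (norm_add_le _ _).trans (add_le_add (hcJ z μ ν hμν) hR)


/-! ## §1 The error field is exact over the corner junk -/

include hWP hφ0P hφ1P in
/-- **`dirIter E′ = gaugeDir_V j_c`**: `dirIter(J + Rφ⁰ − Rφ¹) = dirIter J + φ⁰ − φ¹ = gaugeDir_V j_c` (`rightInvW` is an exact right inverse, `φ⁰ − φ¹ = −dirIter J + gaugeDir_V j_c`). [folklore] -/
theorem dirIter_errorField0 (i₀ : Fin d) (hdφ : ∀ z κ, φ0 z κ - φ1 z κ = -dirIter L (k + 1) W J z κ + gaugeDir (cavgIter L (k + 1) W) jc z κ) :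
    dirIter L (k + 1) W (fun y κ => J y κ + (rightInvW0 hL k hWu hx hs hWx N hθ hE hφ0 y κ - rightInvW0 hL k hWu hx hs hWx N hθ hE hφ1 y κ))
      = gaugeDir (cavgIter L (k + 1) W) jc := by
  have hL1 : 1 ≤ L := by omega
  have e : (fun y κ => J y κ + (rightInvW0 hL k hWu hx hs hWx N hθ hE hφ0 y κ - rightInvW0 hL k hWu hx hs hWx N hθ hE hφ1 y κ))
      = fun y κ => J y κ + (fun y κ => rightInvW0 hL k hWu hx hs hWx N hθ hE hφ0 y κ - rightInvW0 hL k hWu hx hs hWx N hθ hE hφ1 y κ) y κ := rfl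
  rw [e, dirIter_add hL1 k hWu hx hs hWx, dirIter_sub hL1 k hWu hx hs hWx, dirIter_rightInvW0 hL k hWu hx hs hWx N hθ hE hφ0 hWP hφ0P i₀,
    dirIter_rightInvW0 hL k hWu hx hs hWx N hθ hE hφ1 hWP hφ1P i₀]
  funext z κ
  simp only [hdφ z κ]
  abel

/-! ## §2 One step, split and sized -/

include hWP hφ0P hφ1P in
/-- **ONE STEP OF THE (S1) ITERATION, SPLIT AND SIZED** (multi-level small-field class at level `k+1`, `d ≥ 1`, `L ≥ 2`, `W` unitary `(tower L N (k+1))`-periodic with `SmallField W x`, Poincaré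
parameter `θ_P ≤ 1∕2`, `cruxC·M²x < 1`, `M²x ≤ 1`, `curvSum ≤ 2L∕3`, the curved sup letter (L) with constant `K ≥ 0` displayed as `hLet` and the absorption `16Kd·M²x ≤ 1∕2`): with the step data of
the header (`Ỹ⁰ ∈ 𝒯_E`, `J`, `j_c`, `φ⁰ − φ¹ = −dirIter J + gaugeDir_V j_c`, `h¹ − framePotW Ỹ⁰ = j_c`, sizes `e_J, c_J, e_c` and any `e_E, c_E` above the error-field sizes), the next tangent part
`T¹ = Ỹ⁰ + (J + Rφ⁰ − Rφ¹)` splits with datum `h¹`, and the displayed sizes hold (`M = L^{k+1}`, `s_E := 2KM·c_E + 8K(M²x)(frameC·M·e_E + e_c)∕M + 16Kd(M²x)·e_E`). [folklore] -/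
theorem one_step_split_sized0 (hd : 0 < d)
    (hθP : 4 * (d : ℝ) ^ 2 * ((L : ℝ) ^ (k + 1) - 1) ^ 2 * x + 16 * d * loopRad d L ((prop1Radius d L)^[k] x)
        + 4 * d * ((d : ℝ) - 1) * ((L : ℝ) ^ (k + 1) - 1) ^ 2 * x ≤ 1 / 2)
    {K : ℝ} (hK : 0 ≤ K) (hKε : 16 * K * d * (((L : ℝ) ^ (k + 1)) ^ 2 * x) ≤ 1 / 2)
    (hLet : ∀ Y : Site d → Fin d → Matrix n n ℂ, Y ∈ energyBlockLandauW (d := d) (n := n) L N (k + 1) W →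
      ∀ B : ℝ, (∀ (z : Site d) (μ ν : Fin d), μ ≠ ν → ‖curlAt W Y z μ ν‖ ≤ B) → ∀ (y : Site d) (κ : Fin d), ‖Y y κ‖ ≤ K * (L : ℝ) ^ (k + 1) * B)
    (hε : ((L : ℝ) ^ (k + 1)) ^ 2 * x ≤ 1) (hA : curvSum d L (k + 1) x ≤ 2 / 3 * L)
    {Yt0 : Site d → Fin d → Matrix n n ℂ} (hYt0 : Yt0 ∈ energyBlockLandauW (d := d) (n := n) L N (k + 1) W)
    (hJs : IsSkewDir J) (hJP : IsPeriodicDir J ((tower L N (k + 1) : ℕ) : ℤ))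
    (hjcs : ∀ z, jc z ∈ skewAdjoint (Matrix n n ℂ)) (hjcP : ∀ (z : Site d) (i : Fin d), jc (z + (N : ℤ) • e i) = jc z)
    (hdφ : ∀ z κ, φ0 z κ - φ1 z κ = -dirIter L (k + 1) W J z κ + gaugeDir (cavgIter L (k + 1) W) jc z κ)
    {h1 : Site d → Matrix n n ℂ} (hdat : ∀ z, h1 z - framePotW L (k + 1) W Yt0 z = jc z)
    {eJ cJ ec eE cE : ℝ} (heJ0 : 0 ≤ eJ) (hec0 : 0 ≤ ec) (heE0 : 0 ≤ eE) (hcE0 : 0 ≤ cE)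
    (hJ : ∀ y κ, ‖J y κ‖ ≤ eJ) (hcJ : ∀ (z : Site d) (μ ν : Fin d), μ ≠ ν → ‖curlAt W J z μ ν‖ ≤ cJ) (hjc : ∀ z, ‖jc z‖ ≤ ec)
    (heE : eJ + supC0 d L / ((L : ℝ) ^ (k + 1) * (1 - cruxC d L * (((L : ℝ) ^ (k + 1)) ^ 2 * x))) * ((3 + 12 * (d : ℝ)) * (L : ℝ) ^ (k + 1) * eJ + 2 * ec) ≤ eE)
    (hcE : cJ + supCurlC0 d L / (((L : ℝ) ^ (k + 1)) ^ 2 * (1 - cruxC d L * (((L : ℝ) ^ (k + 1)) ^ 2 * x))) * ((3 + 12 * (d : ℝ)) * (L : ℝ) ^ (k + 1) * eJ + 2 * ec) ≤ cE) :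
    ∃ (ζ : Site d → Matrix n n ℂ) (Yt1 : Site d → Fin d → Matrix n n ℂ),
      (∀ y, ζ y ∈ skewAdjoint (Matrix n n ℂ)) ∧ (∀ (y : Site d) (i : Fin d), ζ (y + ((tower L N (k + 1) : ℕ) : ℤ) • e i) = ζ y) ∧
      Yt1 ∈ energyBlockLandauW (d := d) (n := n) L N (k + 1) W ∧
      (∀ y μ, Yt0 y μ + (J y μ + (rightInvW0 hL k hWu hx hs hWx N hθ hE hφ0 y μ - rightInvW0 hL k hWu hx hs hWx N hθ hE hφ1 y μ)) = Yt1 y μ + gaugeDir W ζ y μ) ∧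
      (∀ z, bmeanIterW L (k + 1) W ζ z
          = -(framePotW L (k + 1) W (fun y μ => Yt0 y μ + (J y μ + (rightInvW0 hL k hWu hx hs hWx N hθ hE hφ0 y μ - rightInvW0 hL k hWu hx hs hWx N hθ hE hφ1 y μ))) z - h1 z)) ∧
      (∀ z, ‖framePotW L (k + 1) W (fun y μ => Yt0 y μ + (J y μ + (rightInvW0 hL k hWu hx hs hWx N hθ hE hφ0 y μ - rightInvW0 hL k hWu hx hs hWx N hθ hE hφ1 y μ))) z - h1 z‖
          ≤ frameC d L * (L : ℝ) ^ (k + 1) * eE + ec) ∧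
      (∀ y μ, ‖Yt1 y μ - Yt0 y μ‖ ≤ 2 * K * (L : ℝ) ^ (k + 1) * cE + 8 * K * (((L : ℝ) ^ (k + 1)) ^ 2 * x) * (frameC d L * (L : ℝ) ^ (k + 1) * eE + ec) / (L : ℝ) ^ (k + 1)
          + 16 * K * d * (((L : ℝ) ^ (k + 1)) ^ 2 * x) * eE) ∧
      (∀ y μ, ‖gaugeDir W ζ y μ‖ ≤ eE + (2 * K * (L : ℝ) ^ (k + 1) * cE + 8 * K * (((L : ℝ) ^ (k + 1)) ^ 2 * x) * (frameC d L * (L : ℝ) ^ (k + 1) * eE + ec) / (L : ℝ) ^ (k + 1)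
          + 16 * K * d * (((L : ℝ) ^ (k + 1)) ^ 2 * x) * eE)) ∧
      (∀ y, ‖ζ y‖ ≤ 2 * ((frameC d L * (L : ℝ) ^ (k + 1) * eE + ec) + 2 * d * (L : ℝ) ^ (k + 1) *
          (eE + (2 * K * (L : ℝ) ^ (k + 1) * cE + 8 * K * (((L : ℝ) ^ (k + 1)) ^ 2 * x) * (frameC d L * (L : ℝ) ^ (k + 1) * eE + ec) / (L : ℝ) ^ (k + 1)
            + 16 * K * d * (((L : ℝ) ^ (k + 1)) ^ 2 * x) * eE)))) := by
  have hL1 : 1 ≤ L := by omega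
  -- the error field, its exactness and its sizes
  have hEs := errorField_skew0 (N := N) hL k hWu hx hs hWx hθ hE hφ0 hφ1 hJs
  have hEP := errorField_periodic0 hL k hWu hWP hx hs hWx hθ hE hφ0 hφ1 hJP
  have hdir := dirIter_errorField0 hL k hWu hWP hx hs hWx hθ hE hφ0 hφ1 hφ0P hφ1P ⟨0, hd⟩ hdφ
  have hEle : ∀ y κ, ‖J y κ + (rightInvW0 hL k hWu hx hs hWx N hθ hE hφ0 y κ - rightInvW0 hL k hWu hx hs hWx N hθ hE hφ1 y κ)‖ ≤ eE := fun y κ =>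
    (norm_errorField_le0 hL k hWu hWP hx hs hWx hθ hE hε hφ0 hφ1 hA hJs hJP hdφ heJ0 hec0 hJ hjc y κ).trans heE
  have hcE' : ∀ (z : Site d) (μ ν : Fin d), μ ≠ ν →
      ‖curlAt W (fun y κ => J y κ + (rightInvW0 hL k hWu hx hs hWx N hθ hE hφ0 y κ - rightInvW0 hL k hWu hx hs hWx N hθ hE hφ1 y κ)) z μ ν‖ ≤ cE := fun z μ ν hμν =>
    (norm_curlAt_errorField_le0 hL k hWu hWP hx hs hWx hθ hE hε hφ0 hφ1 hA hJs hJP hdφ heJ0 hec0 hJ hcJ hjc z hμν).trans hcE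
  -- the split of the error field, sized
  obtain ⟨ζ, YE, hζs, hζP, hYE, hsplit, hmean, hm, hYEle, hδ, hσ⟩ :=
    split_error_sized hd hL k hWu hWP hx hs hWx hθP hK hKε hLet hEs hEP hjcs hjcP hdir heE0 hcE0 hEle hcE' hjc
  -- the frame mismatch of `T¹` against `h¹` is that of `E′` against `j_c`
  have hframe : ∀ z, framePotW L (k + 1) W (fun y μ => Yt0 y μ + (J y μ + (rightInvW0 hL k hWu hx hs hWx N hθ hE hφ0 y μ - rightInvW0 hL k hWu hx hs hWx N hθ hE hφ1 y μ))) z - h1 z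
      = framePotW L (k + 1) W (fun y κ => J y κ + (rightInvW0 hL k hWu hx hs hWx N hθ hE hφ0 y κ - rightInvW0 hL k hWu hx hs hWx N hθ hE hφ1 y κ)) z - jc z := by
    intro z
    have hfa : framePotW L (k + 1) W (fun y μ => Yt0 y μ + (J y μ + (rightInvW0 hL k hWu hx hs hWx N hθ hE hφ0 y μ - rightInvW0 hL k hWu hx hs hWx N hθ hE hφ1 y μ))) z
        = framePotW L (k + 1) W Yt0 z + framePotW L (k + 1) W (fun y κ => J y κ + (rightInvW0 hL k hWu hx hs hWx N hθ hE hφ0 y κ - rightInvW0 hL k hWu hx hs hWx N hθ hE hφ1 y κ)) z :=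
      framePotW_add hL1 k hWu hx hs hWx Yt0 (fun y κ => J y κ + (rightInvW0 hL k hWu hx hs hWx N hθ hE hφ0 y κ - rightInvW0 hL k hWu hx hs hWx N hθ hE hφ1 y κ)) z
    rw [hfa, ← hdat z]
    abel
  refine ⟨ζ, fun y μ => Yt0 y μ + YE y μ, hζs, hζP, mem_energyBlockLandauW_add hL1 k hWu hx hs hWx hYt0 hYE, fun y μ => ?_, fun z => ?_, fun z => ?_, fun y μ => ?_, hδ, hσ⟩
  · rw [hsplit y μ, add_assoc]
  · rw [hmean z, hframe z]
  · rw [hframe z]; exact hm z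
  · rw [add_sub_cancel_left]; exact hYEle y μ


end OneStep

end

end Summit.QuantumFields.BalabanUV.T4Continuum.NE7SliceStepOneStepNL0
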